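import Mathlib
import HarnessLib
import Summits.CriticalPhenomena.SAWScalingLimit.Theses.SAWDefectDecoherence
import Literature.Barriers.CriticalPhenomena.ParafermionicHalfCauchyRiemann

/-!
# Ideator-3 sketch for crux `BoundaryClosureR` (stmt-CriticalPhenomena-14004), card `polygon-squeeze-flux-trace`

Typed here (all elaborate; none proved here):
* `ArrivalMonotone`      — FIRST LEMMA (provable now): domain monotonicity of the σ = 0 arrival masses.
* `ArrivalRatioSqueeze`  — the squeeze of the b-normalised arrival profile of `Λ` between nested `Λ⁻ ⊆ Λ ⊆ Λ⁺`.
* `CollarAvoidance`      — K2 of the card: the chordal critical walk `a_δ → b_δ` does not hug the boundary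
                           (removing the macroscopic η-collar outside the two pinned balls costs a factor ≥ 1 − ε).
* `FlatArcUniqueness`    — P3 of the card (pure complex analysis): a holomorphic, integrable `g` on a half-ball whose
                           Green trace on the flat diameter vanishes is identically zero.
-/

namespace Summit.CriticalPhenomena.SAWScalingLimit.Cruxes.BoundaryClosureR.Ideator3Sketch

open scoped BigOperators Topology Classical
open Filter Set MeasureTheory
open Literature.Probability.RandomPlanarGeometry Literature.Probability.RandomPlanarGeometry.SAW
open Literature.Probability.LatticeModels

/-- FIRST LEMMA (exact, provable now by injecting walk sets): for `Λ ⊆ Λ'` every self-avoiding walk of the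
smaller domain is one of the larger, so the `σ = 0` observable (a sum of `x^ℓ ≥ 0`) is monotone in the domain. -/
def ArrivalMonotone : Prop :=
  ∀ (Λ Λ' : Finset HexVertex), Λ ⊆ Λ' → ∀ (a z : Sym2 HexVertex) (x : ℝ), 0 ≤ x →
    ‖hexParafermionicObservable Λ a x 0 z‖ ≤ ‖hexParafermionicObservable Λ' a x 0 z‖

/-- The squeeze (one line from `ArrivalMonotone`): for `Λ⁻ ⊆ Λ ⊆ Λ⁺` and mid-edges `a, b, e`,
`Z⁻(e)/Z⁺(b) ≤ Z(e)/Z(b) ≤ Z⁺(e)/Z⁻(b)`, i.e. `θ·r⁻(e) ≤ r(e) ≤ θ⁻¹·r⁺(e)` with `θ = Z⁻(b)/Z⁺(b)`. -/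
def ArrivalRatioSqueeze : Prop :=
  ∀ (Λm Λ Λp : Finset HexVertex), Λm ⊆ Λ → Λ ⊆ Λp → ∀ (a b e : Sym2 HexVertex),
    let Z : Finset HexVertex → Sym2 HexVertex → ℝ :=
      fun L z => ‖hexParafermionicObservable L a hexCriticalFugacity 0 z‖
    0 < Z Λm b →
      Z Λm e / Z Λp b ≤ Z Λ e / Z Λ b ∧ Z Λ e / Z Λ b ≤ Z Λp e / Z Λm b

/-- K2 `CollarAvoidance` (positive masses only), in the frame of the repaired target `HexObservableLimitR`:
for an admissible family of a Dobrushin domain pinned flat at both marked points, deleting from `Λ_δ` every vertex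
whose rescaled centre lies within macroscopic distance `η` of `ℂ ∖ Ω` and outside the two rigid `ρ`-balls lowers the
`a_δ → b_δ` partition function by a factor at most `1 − ε`, eventually in `δ`, once `η = η(ε)` is small.
(Used by the card only for exact hex-direction polygonal families; stated for all admissible families.) -/
def CollarAvoidance : Prop :=
  ∀ (D : DobrushinDomain) (ρ : ℝ) (Λ : ℝ → Finset HexVertex) (m : Fin 2 → ℝ → ℤ)
    (a b : ℝ → Sym2 HexVertex),
    let Z : Finset HexVertex → ℝ → ℝ := fun L δ =>
      ‖hexParafermionicObservable L (a δ) hexCriticalFugacity 0 (b δ)‖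
    0 < ρ →
    (∀ i : Fin 2, D.carrier ∩ Metric.ball (D.pt i) ρ = {z : ℂ | (D.pt i).im < z.im} ∩ Metric.ball (D.pt i) ρ) →
    (∀ᶠ δ : ℝ in 𝓝[>] 0,
      hexDomainSimplyConnected (Λ δ) ∧ a δ ∈ hexDomainBoundary (Λ δ) ∧ b δ ∈ hexDomainBoundary (Λ δ) ∧
      Nonempty (HexMidEdgeSAW (Λ δ) (a δ) (b δ)) ∧
      (hexGraph.induce ((Λ δ : Finset HexVertex) : Set HexVertex)).Preconnected ∧
      (∀ v ∈ Λ δ, (δ : ℂ) * hexCenter v ∈ D.carrier) ∧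
      (∀ i : Fin 2, ∀ v : HexVertex, (δ : ℂ) * hexCenter v ∈ Metric.ball (D.pt i) ρ →
        (v ∈ Λ δ ↔ m i δ ≤ v.1 1))) →
    (∀ K : Set ℂ, IsCompact K → K ⊆ D.carrier →
      ∀ᶠ δ : ℝ in 𝓝[>] 0, ∀ v : HexVertex, (δ : ℂ) * hexCenter v ∈ K → v ∈ Λ δ) →
    Tendsto (fun δ : ℝ => (δ : ℂ) * hexMidpoint (a δ)) (𝓝[>] 0) (𝓝 (D.pt 0)) →
    Tendsto (fun δ : ℝ => (δ : ℂ) * hexMidpoint (b δ)) (𝓝[>] 0) (𝓝 (D.pt 1)) →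
    ∀ ε : ℝ, 0 < ε → ∃ η : ℝ, 0 < η ∧ ∀ᶠ δ : ℝ in 𝓝[>] 0,
      (1 - ε) * Z (Λ δ) δ ≤
        Z ((Λ δ).filter fun v =>
              η ≤ Metric.infDist ((δ : ℂ) * hexCenter v) D.carrierᶜ ∨
              (δ : ℂ) * hexCenter v ∈ Metric.ball (D.pt 0) ρ ∨
              (δ : ℂ) * hexCenter v ∈ Metric.ball (D.pt 1) ρ) δ

/-- The Wirtinger derivative `∂̄φ = (φ_x + i φ_y)/2` of a real-differentiable `φ : ℂ → ℂ`. -/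
noncomputable def dbar (φ : ℂ → ℂ) (z : ℂ) : ℂ :=
  ((fderiv ℝ φ z) 1 + Complex.I * (fderiv ℝ φ z) Complex.I) / 2

/-- P3 `FlatArcUniqueness` (classical: distributional Schwarz reflection + Weyl + identity theorem): a function
holomorphic and integrable on the upper half of a ball, whose Green pairing `∫ g ∂̄φ` vanishes for every smooth
`φ` compactly supported in the WHOLE ball (not only in the half-ball), vanishes identically. In the card it is
applied to `g − c (Φ'/Φ'(b))^{5/8}` on the rigid ball at `b`. -/
def FlatArcUniqueness : Prop :=
  ∀ (g : ℂ → ℂ) (c : ℂ) (r : ℝ), 0 < r →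
    let U : Set ℂ := Metric.ball c r ∩ {z : ℂ | c.im < z.im}
    DifferentiableOn ℂ g U → IntegrableOn g U →
    (∀ φ : ℂ → ℂ, ContDiff ℝ 2 φ → HasCompactSupport φ → tsupport φ ⊆ Metric.ball c r →
      ∫ z in U, g z * dbar φ z = 0) →
    EqOn g 0 U

end Summit.CriticalPhenomena.SAWScalingLimit.Cruxes.BoundaryClosureR.Ideator3Sketch
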